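import Literature.MathematicalPhysics.QuantumFieldTheory.ConformalBootstrap3D.PointKernelLower

/-!
# The lower-box kernel certificate theorem with the (M) boxes `s`-covered

`PCert.boxExcluded_of_kernelC_lowerS` (PointKernelLower) takes the (M) box facts FULL WIDTH in
`s = Δ_σ`: `0 ≤ termCornerBound … s_lo s_hi`.  The corner number is a corner in `s` as well as in
`E`, so its slack has a part `∝ (s_hi - s_lo)` that no `E`-refinement removes: on the pub-ising3d
lower box `[0.505, 0.510] × [0.6, 0.95)` (width `1/200` in `s`) the (M) rows `j = 23, 24` have a
NEGATIVE full-width corner number at zero `E`-width near `E = E₀ = 24` although the termwise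
functional is positive there (`≈ 6·10⁻⁶`), while on the two `s`-halves the corner numbers are
positive.  This file gives the variant in which the (M) rows are certified PER `s`-PIECE of a
rational partition `σM_0 = s_lo, …, σM_{K_M} = s_hi`, every piece with its own box rows (kernel:
`mBlockOK` on the piece certificates `c.withS …` of PointKernelScover, whose `wR / zR / zbR / eM`
are the certificate's):

* `ruleM_of_cornerTables_pieces` — the termwise hypothesis (M) of the rules schema
  (`boxExcluded_of_pointRules_twistI`) from per-piece corner box tables (`termCornerBound_le`);
* `boxExcluded_of_pointTable₂SEM` — the two-row lower table theorem `boxExcluded_of_pointTable₂SE`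
  with (M) taken in termwise (semantic) form;
* `PCert.boxExcluded_of_kernelC_lowerSM` — the kernel certificate theorem: hypotheses of
  `boxExcluded_of_kernelC_lowerS` verbatim except (M), which is per piece.

[cite: HogervorstRychkov2013, §3 eq. (3.6)]
-/

noncomputable section

namespace Literature.MathematicalPhysics.QuantumFieldTheory.ConformalBootstrap3D

open Literature.Analysis.ValidatedNumerics (rall of_rall)
open Real Finset Set

/-! ### (M) from per-piece corner box tables -/

/-- **Rule (M) from corner box tables on the pieces of an `s`-partition.** For every piece
`[σ_i, σ_{i+1}]` of `σ_0 = s_lo, …, σ_P = s_hi` a box table in `E` (row `j` from `≤ max(E₀, j+τ)`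
to `≥ E_T`) with nonnegative corner numbers gives `0 ≤ φ[F^{s}_-[𝒫_{E,j}]]` for all
`E₀ ≤ E < E_T`, `j + τ ≤ E`, `s ∈ [s_lo, s_hi]`. [folklore] -/
theorem ruleM_of_cornerTables_pieces {N : ℕ} (w z zb : Fin N → ℝ)
    (hz : ∀ k, z k ∈ Ioo (0 : ℝ) 1) (hzb : ∀ k, zb k ∈ Ioo (0 : ℝ) 1)
    {Q : Set (ℝ × ℝ)} {slo shi E₀ ET : ℝ} (τ : ℝ) (hQ : ∀ p ∈ Q, slo ≤ p.1 ∧ p.1 ≤ shi)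
    (P : ℕ) (σ : ℕ → ℝ) (hP : 0 < P) (hσ0 : σ 0 = slo) (hσP : σ P = shi)
    (e : ℕ → ℕ → ℕ → ℝ) (M : ℕ → ℕ → ℕ)
    (he : ∀ i < P, ∀ j : ℕ, (j : ℝ) + τ < ET → e i j 0 ≤ max E₀ ((j : ℝ) + τ) ∧ ET ≤ e i j (M i j))
    (hbox : ∀ i < P, ∀ j : ℕ, (j : ℝ) + τ < ET → ∀ m < M i j,
      0 ≤ termCornerBound w z zb j (e i j m) (e i j (m + 1)) (σ i) (σ (i + 1))) :
    ∀ (j : ℕ) (E : ℝ), E₀ ≤ E → E < ET → (j : ℝ) + τ ≤ E → ∀ p ∈ Q,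
      0 ≤ pointFunctional w z zb (crossF p.1 (-1) (zMono E j)) := by
  intro j E hE0 hET hjE p hp
  have hjT : (j : ℝ) + τ < ET := lt_of_le_of_lt hjE hET
  obtain ⟨i, hi, hsi⟩ := exists_piece_Icc σ P hP p.1
    ⟨by rw [hσ0]; exact (hQ p hp).1, by rw [hσP]; exact (hQ p hp).2⟩
  obtain ⟨he0, heM⟩ := he i hi j hjT
  have hE : E ∈ Ico (e i j 0) (e i j (M i j)) := ⟨he0.trans (max_le hE0 hjE), lt_of_lt_of_le hET heM⟩
  obtain ⟨m, hm, hEm⟩ := exists_cell_Ico (e i j) (M i j) E hE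
  exact (hbox i hi j hjT m hm).trans (termCornerBound_le w z zb hz hzb j ⟨hEm.1, hEm.2.le⟩ hsi)

/-! ### The two-row lower table, (M) termwise -/

/-- **Two-row LOWER-box table, `s`-covered head cells in existential form, (O1) direct, (M)
termwise.** `boxExcluded_of_pointTable₂SE` with the (M) box rows replaced by their consequence
`0 ≤ φ[F^{s}_-[𝒫_{E,j}]]` (`E₀ ≤ E < E_T`, `j + τ ≤ E`, on `Q`) — to be supplied full width
(`ruleM_of_boxTable_twist`), `s`-covered per box (`ruleM_of_boxTable_twist_scover`) or per piece
(`ruleM_of_cornerTables_pieces`). [cite: HogervorstRychkov2013, §3 eq. (3.6)] -/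
theorem boxExcluded_of_pointTable₂SEM {N : ℕ} {w z zb : Fin N → ℝ}
    (hz : ∀ k, z k ∈ Ioo (0 : ℝ) 1) (hzb : ∀ k, zb k ∈ Ioo (0 : ℝ) 1) (hord : ∀ k, zb k ≤ z k)
    (apex : Fin N) (hapex : 0 ≤ w apex) (qd qr : Fin N → ℝ) (hqd : ∀ k, 0 < qd k ∧ qd k ≤ 1)
    (hqr : ∀ k, 0 < qr k ∧ qr k ≤ 1)
    (hdomd : ∀ k, z k * zb k ≤ qd k ^ 2 * (z apex * zb apex) ∧ z k ≤ qd k * z apex)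
    (hdomr : ∀ k, (1 - z k) * (1 - zb k) ≤ qr k ^ 2 * (z apex * zb apex) ∧
      1 - zb k ≤ qr k * z apex)
    {Q : Set (ℝ × ℝ)} {slo shi εlo εhi E₀ ET τ : ℝ}
    (t : ℕ → ℕ → ℝ) (K : ℕ → ℕ) (nF : ℕ → ℕ → ℕ) (hc : ℕ → ℕ → Bool)
    (tε : ℕ → ℝ) (Kε : ℕ) (nFε : ℕ → ℕ) (hcε : ℕ → Bool)
    (hQ : ∀ p ∈ Q, (slo ≤ p.1 ∧ p.1 ≤ shi) ∧
      ((εlo ≤ p.2 ∧ p.2 < εhi) ∨ (t 0 0 ≤ p.2 ∧ p.2 < E₀)))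
    (L : ℕ) (hL : E₀ ≤ (L : ℝ) + 1) (hτ1 : τ ≤ 1) (hτ0 : τ ≤ E₀)
    (hr : ∀ k, 1 / 2 ≤ ((1 - z k) * (1 - zb k)) ^ (shi - slo) ∧ 1 / 2 ≤ (z k * zb k) ^ (shi - slo))
    -- (O1), on `Q` itself
    (hI : ∀ p ∈ Q, 0 < pointFunctional w z zb (crossF p.1 (-1) (fun _ _ => (1 : ℝ))))
    -- the ε-row (ℓ = 0), interval rule, s-covered
    (htε : tε 0 = εlo ∧ tε Kε = εhi)
    (hlowε : ∀ k, k < Kε → 1 / 2 < tε k ∧ τ ≤ tε k)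
    (hnFε : ∀ k, k < Kε → E₀ ≤ tε k + ((nFε k : ℝ) + 1))
    (hρε : ∀ k, k < Kε → hcε k = true → ∀ i, 1 / 2 ≤ (z i * zb i) ^ ((tε (k + 1) - tε k) / 2) ∧
      1 / 2 ≤ ((1 - z i) * (1 - zb i)) ^ ((tε (k + 1) - tε k) / 2))
    (hheadε : ∀ k < Kε,
      ∃ P : ℕ, ∃ σ : ℕ → ℝ, 0 < P ∧ σ 0 = slo ∧ σ P = shi ∧ (∀ i < P, σ i ≤ σ (i + 1)) ∧
        ∀ i < P, 0 ≤ headNumberI w z zb 0 (tε k) (tε (k + 1)) (σ i) (σ (i + 1)) (nFε k) (hcε k))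
    -- the scalar row (ℓ = 0, from ≤ 3 to E₀) and the spinning rows, monotone rule, s-covered
    (ht0 : t 0 0 ≤ 3 ∧ t 0 (K 0) = E₀)
    (htℓ : ∀ ℓ, Even ℓ → ℓ ≠ 0 → ℓ < L → t ℓ 0 = (ℓ : ℝ) + 1 ∧ t ℓ (K ℓ) = E₀)
    (hlow : ∀ ℓ k, k < K ℓ → (ℓ : ℝ) + 1 ≤ t ℓ k)
    (hnF : ∀ ℓ k, k < K ℓ → E₀ ≤ t ℓ k + ((nF ℓ k : ℝ) + 1))
    (hρ : ∀ ℓ k, k < K ℓ → hc ℓ k = true → ∀ i, 1 / 2 ≤ (z i * zb i) ^ ((t ℓ (k + 1) - t ℓ k) / 2) ∧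
      1 / 2 ≤ ((1 - z i) * (1 - zb i)) ^ ((t ℓ (k + 1) - t ℓ k) / 2))
    (hhead : ∀ ℓ, (ℓ = 0 ∨ (Even ℓ ∧ ℓ < L)) → ∀ k < K ℓ,
      ∃ P : ℕ, ∃ σ : ℕ → ℝ, 0 < P ∧ σ 0 = slo ∧ σ P = shi ∧ (∀ i < P, σ i ≤ σ (i + 1)) ∧
        ∀ i < P, 0 ≤ headNumber w z zb ℓ (t ℓ k) (t ℓ (k + 1)) (σ i) (σ (i + 1)) (nF ℓ k) (hc ℓ k))
    -- (M), termwise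
    (hM : ∀ (j : ℕ) (E : ℝ), E₀ ≤ E → E < ET → (j : ℝ) + τ ≤ E → ∀ p ∈ Q,
      0 ≤ pointFunctional w z zb (crossF p.1 (-1) (zMono E j)))
    -- (T)
    (hB : ∑ k ∈ univ.erase apex, |w k| * ((1 - z k) * (1 - zb k)) ^ slo * qd k ^ ET
          + ∑ k, |w k| * (z k * zb k) ^ slo * qr k ^ ET ≤
          w apex * ((1 - z apex) * (1 - zb apex)) ^ shi) :
    BoxExcluded Q := by
  have hQ1 : ∀ p ∈ Q, slo ≤ p.1 ∧ p.1 ≤ shi := fun p hp => (hQ p hp).1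
  -- every cell of the scalar and spinning rows (monotone coefficient bit)
  have hcell : ∀ ℓ, (ℓ = 0 ∨ (Even ℓ ∧ ℓ < L)) → ∀ k < K ℓ, ∀ p ∈ Q,
      ∀ Δ ∈ Ico (t ℓ k) (t ℓ (k + 1)), BlockPositive (pointFunctional w z zb) p.1 Δ ℓ := by
    intro ℓ hℓ k hk
    obtain ⟨P, σ, hP, hσ0, hσP, hmono, hnum⟩ := hhead ℓ hℓ k hk
    exact cell_of_headNumber₂_scover w z zb hz hzb hord apex hapex qd qr hqd hqr hdomd hdomr hQ1 hτ1
      hM hB hr (nF ℓ k) (hnF ℓ k hk) (hc ℓ k) false (fun _ => hlow ℓ k hk) (fun h => absurd h (by simp))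
      (hρ ℓ k hk) σ P hP hσ0 hσP hmono
      (fun i hi => by simpa [headNumber₂] using hnum i hi)
  -- every cell of the ε-row (interval coefficient bit)
  have hb0 : unitarityBound3D 0 = 1 / 2 := by simp [unitarityBound3D]
  have hcellε : ∀ k < Kε, ∀ p ∈ Q,
      ∀ Δ ∈ Ico (tε k) (tε (k + 1)), BlockPositive (pointFunctional w z zb) p.1 Δ 0 := by
    intro k hk
    obtain ⟨P, σ, hP, hσ0, hσP, hmono, hnum⟩ := hheadε k hk
    exact cell_of_headNumber₂_scover w z zb hz hzb hord apex hapex qd qr hqd hqr hdomd hdomr hQ1 hτ1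
      hM hB hr (nFε k) (hnFε k hk) (hcε k) true (fun h => absurd h (by simp))
      (fun _ => by
        obtain ⟨h1, h2⟩ := hlowε k hk
        exact ⟨by rw [hb0]; exact h1, by simpa using h2⟩)
      (hρε k hk) σ P hP hσ0 hσP hmono
      (fun i hi => by simpa [headNumber₂] using hnum i hi)
  refine boxExcluded_of_pointRules_twistI hz hzb hord apex hapex qd qr hqd hqr hdomd hdomr hQ1 hτ1 hτ0
    hI ?_ ?_ ?_ hM hB
  · -- (O2): `Δ_ε` lies in the ε-row or in the scalar row
    intro p hp
    rcases (hQ p hp).2 with hε | h0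
    · exact blockPositive_of_cells_Ico tε Kε hcellε p hp p.2 ⟨htε.1 ▸ hε.1, htε.2 ▸ hε.2⟩
    · exact blockPositive_of_cells_Ico (t 0) (K 0) (hcell 0 (Or.inl rfl)) p hp p.2
        ⟨h0.1, ht0.2 ▸ h0.2⟩
  · -- (O3)
    exact scalar_nonneg_of_cells (t 0) (K 0) ht0.1 ht0.2 (hcell 0 (Or.inl rfl))
  · -- (O4)
    exact spinning_nonneg_of_cells L hL t K (fun ℓ hev hℓ hℓL => (htℓ ℓ hev hℓ hℓL).1.le)
      (fun ℓ hev hℓ hℓL => (htℓ ℓ hev hℓ hℓL).2)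
      (fun ℓ hev hℓ hℓL => hcell ℓ (Or.inr ⟨hev, hℓL⟩))

namespace PointKernel

namespace PCert

variable {c : PCert}

/-- the (M) row bounds (start `≤ max(E₀, j+τ)`, end `≥ E_T`) for every `j` with `j + τ < E_T`,
from the meta check (`j < J` because `E_T ≤ J + τ`). [folklore] -/
theorem mMeta_hyps (rows : List MRow) (E0 τ : ℚ) (ET J : ℕ)
    (hJ : ((ET : ℕ) : ℝ) ≤ (J : ℝ) + ((τ : ℚ) : ℝ)) (hmeta : c.mMetaOK rows E0 τ ET J = true) :
    ∀ j : ℕ, (j : ℝ) + ((τ : ℚ) : ℝ) < ((ET : ℕ) : ℝ) →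
      c.eM rows j 0 ≤ max ((E0 : ℚ) : ℝ) ((j : ℝ) + ((τ : ℚ) : ℝ)) ∧
        ((ET : ℕ) : ℝ) ≤ c.eM rows j (rowAt rows j).steps.length := by
  intro j hj
  have hjJ : j < J := by
    by_contra hcon
    push Not at hcon
    have : (J : ℝ) ≤ j := by exact_mod_cast hcon
    linarith
  exact mMetaOK_sound rows E0 τ ET J hmeta j hjJ

/-- **The kernel certificate theorem, LOWER box, `s`-covered head cells, identity by pieces, (M)
by pieces.** Hypotheses of `boxExcluded_of_kernelC_lowerS` verbatim, except that the (M) box rows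
are given PER PIECE `[σM_i, σM_{i+1}]` (`i < K_M`) of a rational partition `σM_0 = s_lo`,
`σM_{K_M} = s_hi`: rows `mrowsP i` with their meta check and nonnegative corner numbers over the
piece (from `mBlockOK` on the piece certificate `c.withS (σM i) (σM (i+1)) …` through
`mBlockOK_sound`).  CONCLUSION: `BoxExcluded (QBoxL slo shi εlo εhi)`.
[cite: HogervorstRychkov2013, §3 eq. (3.6)] -/
theorem boxExcluded_of_kernelC_lowerSM (hc : c.checkNodes = true) (hside : c.sideOK = true)
    (KI : ℕ) (σI : ℕ → ℚ) (hKI : 0 < KI) (hσI0 : σI 0 = c.slo) (hσIK : σI KI = c.shi)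
    (hIrow : ∀ i < KI, ∀ s ∈ Icc ((σI i : ℚ) : ℝ) ((σI (i + 1) : ℚ) : ℝ),
      0 < pointFunctional c.wR c.zR c.zbR (crossF s (-1) (fun _ _ => (1 : ℝ))))
    (qd qr : List ℚ) (ET : ℕ) (hT : c.tOK qd qr ET = true)
    (εlo εhi t00 E0 τ : ℚ) (L J : ℕ) (hpar : paramOK t00 E0 τ L ET J = true)
    (esegs : List HSeg) (hmetaE : eMetaOK c.rho esegs εlo εhi E0 τ = true)
    (hsegs : List HSeg) (hmetaH : hMetaOK c.rho hsegs t00 E0 L = true)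
    (KM : ℕ) (σM : ℕ → ℚ) (hKM : 0 < KM) (hσM0 : σM 0 = c.slo) (hσMK : σM KM = c.shi)
    (mrowsP : ℕ → List MRow) (hmetaM : ∀ i < KM, c.mMetaOK (mrowsP i) E0 τ ET J = true)
    (hecells : ∀ i < esegs.length, ∀ x ∈ segCells c.rho (segAt esegs i), c.CellFactIS (segAt esegs i).ell x)
    (hcells : ∀ i < hsegs.length, ∀ x ∈ segCells c.rho (segAt hsegs i), c.CellFactS (segAt hsegs i).ell x)
    (hboxes : ∀ i < KM, ∀ j < J, ∀ m < (rowAt (mrowsP i) j).steps.length,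
      0 ≤ termCornerBound c.wR c.zR c.zbR j (c.eM (mrowsP i) j m) (c.eM (mrowsP i) j (m + 1))
        ((σM i : ℚ) : ℝ) ((σM (i + 1) : ℚ) : ℝ)) :
    BoxExcluded (QBoxL c.slo c.shi εlo εhi) := by
  simp only [paramOK, Bool.and_eq_true, decide_eq_true_eq] at hpar
  obtain ⟨⟨⟨⟨⟨h3, hL⟩, hτ1⟩, hτ0⟩, hJ⟩, hL0⟩ := hpar
  obtain ⟨hqd, hqr, hdomd, hdomr, hB⟩ := t_hyps hc qd qr ET hT
  obtain ⟨ht0, htℓ, hlow, hnF, hcell⟩ := head_hyps c.rho hsegs t00 E0 L hmetaH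
  obtain ⟨htε, hlowε, hnFε, hcellε⟩ := ehead_hyps c.rho esegs εlo εhi E0 τ hmetaE
  -- the facts of cell `k` of row `ℓ` / of the ε-row
  have hF : ∀ ℓ k, k < KH c.rho hsegs ℓ → c.CellFactS ℓ (cellAt c.rho hsegs ℓ k) := by
    intro ℓ k hk
    obtain ⟨-, -, i, hi, hell, hmem⟩ := hcell ℓ k hk
    have := hcells i hi _ hmem
    rwa [hell] at this
  have hFε : ∀ k, k < KH c.rho esegs 0 → c.CellFactIS 0 (cellAt c.rho esegs 0 k) := by
    intro k hk
    obtain ⟨-, -, i, hi, hell, hmem⟩ := hcellε k hk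
    have := hecells i hi _ hmem
    rwa [hell] at this
  have hhead : ∀ ℓ, (ℓ = 0 ∨ (Even ℓ ∧ ℓ < L)) → ∀ k < KH c.rho hsegs ℓ,
      ∃ P : ℕ, ∃ σ : ℕ → ℝ, 0 < P ∧ σ 0 = ((c.slo : ℚ) : ℝ) ∧ σ P = ((c.shi : ℚ) : ℝ) ∧
        (∀ i < P, σ i ≤ σ (i + 1)) ∧
        ∀ i < P, 0 ≤ headNumber c.wR c.zR c.zbR ℓ (tH c.rho hsegs ℓ k) (tH c.rho hsegs ℓ (k + 1))
          (σ i) (σ (i + 1)) (nFH c.rho hsegs ℓ k) (bH c.rho hsegs ℓ k) := by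
    intro ℓ _ k hk
    obtain ⟨e1, e2, -⟩ := hcell ℓ k hk
    obtain ⟨⟨P, σ, hP, hσ0, hσP, hmono, hnum⟩, -⟩ := hF ℓ k hk
    refine ⟨P, σ, hP, hσ0, hσP, hmono, fun i hi => ?_⟩
    rw [e1, e2, nFH, bH]
    exact hnum i hi
  have hheadε : ∀ k < KH c.rho esegs 0,
      ∃ P : ℕ, ∃ σ : ℕ → ℝ, 0 < P ∧ σ 0 = ((c.slo : ℚ) : ℝ) ∧ σ P = ((c.shi : ℚ) : ℝ) ∧
        (∀ i < P, σ i ≤ σ (i + 1)) ∧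
        ∀ i < P, 0 ≤ headNumberI c.wR c.zR c.zbR 0 (tH c.rho esegs 0 k) (tH c.rho esegs 0 (k + 1))
          (σ i) (σ (i + 1)) (nFH c.rho esegs 0 k) (bH c.rho esegs 0 k) := by
    intro k hk
    obtain ⟨e1, e2, -⟩ := hcellε k hk
    obtain ⟨⟨P, σ, hP, hσ0, hσP, hmono, hnum⟩, -⟩ := hFε k hk
    refine ⟨P, σ, hP, hσ0, hσP, hmono, fun i hi => ?_⟩
    rw [e1, e2, nFH, bH]
    exact hnum i hi
  have hρ : ∀ ℓ k, k < KH c.rho hsegs ℓ → bH c.rho hsegs ℓ k = true → ∀ i : Fin c.N,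
      1 / 2 ≤ (c.zR i * c.zbR i) ^ ((tH c.rho hsegs ℓ (k + 1) - tH c.rho hsegs ℓ k) / 2) ∧
      1 / 2 ≤ ((1 - c.zR i) * (1 - c.zbR i)) ^ ((tH c.rho hsegs ℓ (k + 1) - tH c.rho hsegs ℓ k) / 2) := by
    intro ℓ k hk hb i
    obtain ⟨e1, e2, -⟩ := hcell ℓ k hk
    rw [e1, e2]
    exact (hF ℓ k hk).2 hb i
  have hρε : ∀ k, k < KH c.rho esegs 0 → bH c.rho esegs 0 k = true → ∀ i : Fin c.N,
      1 / 2 ≤ (c.zR i * c.zbR i) ^ ((tH c.rho esegs 0 (k + 1) - tH c.rho esegs 0 k) / 2) ∧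
      1 / 2 ≤ ((1 - c.zR i) * (1 - c.zbR i)) ^ ((tH c.rho esegs 0 (k + 1) - tH c.rho esegs 0 k) / 2) := by
    intro k hk hb i
    obtain ⟨e1, e2, -⟩ := hcellε k hk
    rw [e1, e2]
    exact (hFε k hk).2 hb i
  have hJR : ((ET : ℕ) : ℝ) ≤ (J : ℝ) + ((τ : ℚ) : ℝ) := by
    have : (((ET : ℚ)) : ℝ) ≤ (((J : ℚ) + τ : ℚ) : ℝ) := by exact_mod_cast hJ
    push_cast at this; exact this
  -- (O1) from the identity pieces
  have hI : ∀ p ∈ QBoxL c.slo c.shi εlo εhi,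
      0 < pointFunctional c.wR c.zR c.zbR (crossF p.1 (-1) (fun _ _ => (1 : ℝ))) := by
    intro p hp
    obtain ⟨i, hi, hs⟩ := exists_piece_Icc (fun i => ((σI i : ℚ) : ℝ)) KI hKI p.1
      ⟨by simp only [hσI0]; exact hp.1.1, by simp only [hσIK]; exact hp.1.2⟩
    exact hIrow i hi p.1 hs
  -- (M) from the (M) pieces
  have hM := ruleM_of_cornerTables_pieces c.wR c.zR c.zbR (zR_mem hc) (zbR_mem hc)
    (Q := QBoxL c.slo c.shi εlo εhi) (E₀ := ((E0 : ℚ) : ℝ)) (ET := ((ET : ℕ) : ℝ)) ((τ : ℚ) : ℝ)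
    (fun p hp => hp.1) KM (fun i => ((σM i : ℚ) : ℝ)) hKM (by simp only [hσM0]) (by simp only [hσMK])
    (fun i => c.eM (mrowsP i)) (fun i j => (rowAt (mrowsP i) j).steps.length)
    (fun i hi => mMeta_hyps (mrowsP i) E0 τ ET J hJR (hmetaM i hi))
    (fun i hi j hj m hm => by
      have hjJ : j < J := by
        by_contra hcon
        push Not at hcon
        have : (J : ℝ) ≤ j := by exact_mod_cast hcon
        linarith
      exact hboxes i hi j hjJ m hm)
  refine boxExcluded_of_pointTable₂SEM (w := c.wR) (z := c.zR) (zb := c.zbR)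
    (slo := ((c.slo : ℚ) : ℝ)) (shi := ((c.shi : ℚ) : ℝ)) (εlo := ((εlo : ℚ) : ℝ)) (εhi := ((εhi : ℚ) : ℝ))
    (E₀ := ((E0 : ℚ) : ℝ)) (ET := ((ET : ℕ) : ℝ)) (τ := ((τ : ℚ) : ℝ))
    (zR_mem hc) (zbR_mem hc) ?_ ⟨c.apex, apex_lt hc⟩ ?_ (c.qR qd) (c.qR qr) hqd hqr hdomd hdomr
    (tH c.rho hsegs) (KH c.rho hsegs) (nFH c.rho hsegs) (bH c.rho hsegs)
    (tH c.rho esegs 0) (KH c.rho esegs 0) (nFH c.rho esegs 0) (bH c.rho esegs 0)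
    (fun p hp => ⟨hp.1, Or.inl hp.2⟩) L (by exact_mod_cast hL) (by exact_mod_cast hτ1)
    (by exact_mod_cast hτ0) (side_hyp hside) hI htε hlowε hnFε hρε hheadε
    (⟨by rw [ht0.1]; exact_mod_cast h3, ht0.2⟩) htℓ hlow hnF hρ hhead hM hB
  · intro k
    have hn := checkNode_of_checkNodes hc k.2
    simpa [zR, zbR] using (show ((c.zb k : ℚ) : ℝ) ≤ ((c.z k : ℚ) : ℝ) by exact_mod_cast zb_le_z hn)
  · simpa [wR] using (show ((0 : ℚ) : ℝ) ≤ ((c.w c.apex : ℚ) : ℝ) by exact_mod_cast w_apex_nonneg hc)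

end PCert

end PointKernel

end Literature.MathematicalPhysics.QuantumFieldTheory.ConformalBootstrap3D
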